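import Summits.CriticalPhenomena.PercolationContinuityZ3.Theorems.PercNearOneGluingNoHeavyQuantFlowUncross
import Mathlib.Topology.Order.Compact
import HarnessLib

/-!
# QUANT lane R8, T-DEC: NORMAL-FORM FLOWS EXIST — the flow polytope of `LawDec.IsFlowAtT` is compact, so every continuous functional
# (giant-routed mass, the typer's `Φ = G_a − Σ G_l`, a routing cost) is MINIMISED by some flow witness (`exists_isFlowAtT_isMinOn`)

builds on p205010 (kernel theorem, internal audit signed; external expert review pending)

Support file (`--supports stmt-CriticalPhenomena-4575`), QUANT lane seat prim-quant-arm-1 (gen 39), rung R8 of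
`run/shared/lean/prim/quant/LADDER.md`.  Theorems only (no definitions), standard axioms, no sorries.  The "compactness argmax" half of the
normal-form lemma asked for by typer g27 (GATE-MOVE-BLOB-G27 §3/§4(b): "a Lean NF needs a compactness argmax over the flow polytope (+ swap lemmas)")
and by this seat's transfer route to `LawDec.TwinMoveDEC` (TWIN-MOVE-G39 §5: the transferred routing certifies the income criterion from a
giant-MINIMAL flow of `Λ`, 499/500, but not from an arbitrary one, 477/500).

* `LawDec.isFlowAtT_apply_le` — a coordinate bound: `f l h ≤ max (μ l) 0` for a flow witness.
* `LawDec.isCompact_setOf_isFlowAtT` — `{f | IsFlowAtT x T j′ M μ f}` is compact in `ℕ → ℕ → ℝ` (product topology): a closed subset of the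
  box `Π_{l,h} [0, max (μ l) 0]` (Tychonoff).
* **`LawDec.exists_isFlowAtT_isMinOn`** — if `FlowAtT x T j′ M μ` then for every `Φ` continuous on the flow polytope there is a flow witness
  minimising `Φ` among all flow witnesses; `exists_isFlowAtT_isMaxOn` likewise.

[this work]; flow form: prim-quant-stmt g26 (this lane); compactness/extreme value [folklore: Tychonoff, Weierstrass] via Mathlib
(`isCompact_univ_pi`, `IsCompact.exists_isMinOn`).  The gluing rows served [cite: KozmaNitzan2024, Conjecture 3 (p. 15)]; product measure
[cite: Grimmett1999, §1.3 p. 10].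
-/

noncomputable section

namespace Summit.CriticalPhenomena.PercolationContinuityZ3.Theorems

namespace Quant

open Finset Topology

namespace LawDec

/-- a flow witness is coordinatewise bounded: `0 ≤ f l h ≤ max (μ l) 0`. [this work] -/
theorem isFlowAtT_apply_le {x T : ℝ} {j' M : ℕ} {μ : ℕ → ℝ} {f : ℕ → ℕ → ℝ} (hf : IsFlowAtT x T j' M μ f) (l h : ℕ) :
    f l h ≤ max (μ l) 0 := by
  obtain ⟨hf0, hsupp, hrow, _⟩ := hf
  rcases (hf0 l h).eq_or_lt with hz | hp
  · rw [← hz]; exact le_max_right _ _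
  · obtain ⟨hlj, hlow, hhM, _⟩ := hsupp l h hp
    have hr := hrow l hlj hlow
    have : f l h ≤ ∑ h' ∈ Finset.range (M + 1), f l h' :=
      Finset.single_le_sum (fun h' _ => hf0 l h') (Finset.mem_range.2 (by omega))
    rw [hr] at this
    exact this.trans (le_max_left _ _)

/-- **THE FLOW POLYTOPE IS COMPACT** (product topology on `ℕ → ℕ → ℝ`). [this work] -/
theorem isCompact_setOf_isFlowAtT (x T : ℝ) (j' M : ℕ) (μ : ℕ → ℝ) :
    IsCompact {f : ℕ → ℕ → ℝ | IsFlowAtT x T j' M μ f} := by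
  classical
  -- the box
  set K : Set (ℕ → ℕ → ℝ) := Set.pi Set.univ (fun l => Set.pi Set.univ (fun _ => Set.Icc (0 : ℝ) (max (μ l) 0))) with hK
  have hKc : IsCompact K := by
    refine isCompact_univ_pi fun l => ?_
    exact isCompact_univ_pi fun _ => isCompact_Icc
  have hsub : {f : ℕ → ℕ → ℝ | IsFlowAtT x T j' M μ f} ⊆ K := by
    intro f hf
    simp only [hK, Set.mem_pi, Set.mem_univ, true_implies, Set.mem_Icc]
    exact fun l h => ⟨hf.1 l h, isFlowAtT_apply_le hf l h⟩
  -- evaluation is continuous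
  have hev : ∀ l h : ℕ, Continuous fun f : ℕ → ℕ → ℝ => f l h := fun l h =>
    (continuous_apply h).comp (continuous_apply l)
  -- closedness, clause by clause
  have hclosed : IsClosed {f : ℕ → ℕ → ℝ | IsFlowAtT x T j' M μ f} := by
    have e : {f : ℕ → ℕ → ℝ | IsFlowAtT x T j' M μ f}
        = (⋂ l, ⋂ h, {f : ℕ → ℕ → ℝ | 0 ≤ f l h})
          ∩ (⋂ l, ⋂ h, {f : ℕ → ℕ → ℝ | ¬ (l ≤ j' ∧ 2 * (l : ℝ) < T ∧ h ≤ M ∧ (j' + 1 ≤ h ∨ T < (l : ℝ) + h)) → f l h ≤ 0})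
          ∩ (⋂ l, {f : ℕ → ℕ → ℝ | (l ≤ j' ∧ 2 * (l : ℝ) < T) → ∑ h ∈ Finset.range (M + 1), f l h = μ l})
          ∩ (⋂ h, {f : ℕ → ℕ → ℝ | (h ≤ M ∧ (j' + 1 ≤ h ∨ T ≤ 2 * (h : ℝ))) →
              ∑ l ∈ Finset.range (j' + 1), usage x T j' l h * f l h ≤ μ h}) := by
      ext f
      simp only [Set.mem_setOf_eq, Set.mem_inter_iff, Set.mem_iInter, IsFlowAtT]
      constructor
      · rintro ⟨h0, hsupp, hrow, hcap⟩
        refine ⟨⟨⟨h0, fun l h hn => ?_⟩, fun l hl => hrow l hl.1 hl.2⟩, fun h hh => hcap h hh.1 hh.2⟩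
        by_contra hc
        exact hn (hsupp l h (not_le.1 hc))
      · rintro ⟨⟨⟨h0, hsupp⟩, hrow⟩, hcap⟩
        refine ⟨h0, fun l h hp => ?_, fun l hl hlow => hrow l ⟨hl, hlow⟩, fun h hhM habs => hcap h ⟨hhM, habs⟩⟩
        by_contra hn
        exact absurd (hsupp l h hn) (not_le.2 hp)
    rw [e]
    refine ((IsClosed.inter (IsClosed.inter ?_ ?_) ?_).inter ?_)
    · exact isClosed_iInter fun l => isClosed_iInter fun h => isClosed_le continuous_const (hev l h)
    · refine isClosed_iInter fun l => isClosed_iInter fun h => ?_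
      by_cases hc : (l ≤ j' ∧ 2 * (l : ℝ) < T ∧ h ≤ M ∧ (j' + 1 ≤ h ∨ T < (l : ℝ) + h))
      · have : {f : ℕ → ℕ → ℝ | ¬ (l ≤ j' ∧ 2 * (l : ℝ) < T ∧ h ≤ M ∧ (j' + 1 ≤ h ∨ T < (l : ℝ) + h)) → f l h ≤ 0} = Set.univ := by
          ext f; simp only [Set.mem_setOf_eq, Set.mem_univ, iff_true]; exact fun hn => absurd hc hn
        rw [this]; exact isClosed_univ
      · have : {f : ℕ → ℕ → ℝ | ¬ (l ≤ j' ∧ 2 * (l : ℝ) < T ∧ h ≤ M ∧ (j' + 1 ≤ h ∨ T < (l : ℝ) + h)) → f l h ≤ 0}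
            = {f : ℕ → ℕ → ℝ | f l h ≤ 0} := by
          ext f; simp only [Set.mem_setOf_eq]; exact ⟨fun H => H hc, fun H _ => H⟩
        rw [this]; exact isClosed_le (hev l h) continuous_const
    · refine isClosed_iInter fun l => ?_
      by_cases hc : (l ≤ j' ∧ 2 * (l : ℝ) < T)
      · have : {f : ℕ → ℕ → ℝ | (l ≤ j' ∧ 2 * (l : ℝ) < T) → ∑ h ∈ Finset.range (M + 1), f l h = μ l}
            = {f : ℕ → ℕ → ℝ | ∑ h ∈ Finset.range (M + 1), f l h = μ l} := by
          ext f; simp only [Set.mem_setOf_eq]; exact ⟨fun H => H hc, fun H _ => H⟩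
        rw [this]
        exact isClosed_eq (continuous_finsetSum _ fun h _ => hev l h) continuous_const
      · have : {f : ℕ → ℕ → ℝ | (l ≤ j' ∧ 2 * (l : ℝ) < T) → ∑ h ∈ Finset.range (M + 1), f l h = μ l} = Set.univ := by
          ext f; simp only [Set.mem_setOf_eq, Set.mem_univ, iff_true]; exact fun h => absurd h hc
        rw [this]; exact isClosed_univ
    · refine isClosed_iInter fun h => ?_
      by_cases hc : (h ≤ M ∧ (j' + 1 ≤ h ∨ T ≤ 2 * (h : ℝ)))
      · have : {f : ℕ → ℕ → ℝ | (h ≤ M ∧ (j' + 1 ≤ h ∨ T ≤ 2 * (h : ℝ))) →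
              ∑ l ∈ Finset.range (j' + 1), usage x T j' l h * f l h ≤ μ h}
            = {f : ℕ → ℕ → ℝ | ∑ l ∈ Finset.range (j' + 1), usage x T j' l h * f l h ≤ μ h} := by
          ext f; simp only [Set.mem_setOf_eq]; exact ⟨fun H => H hc, fun H _ => H⟩
        rw [this]
        exact isClosed_le (continuous_finsetSum _ fun l _ => continuous_const.mul (hev l h)) continuous_const
      · have : {f : ℕ → ℕ → ℝ | (h ≤ M ∧ (j' + 1 ≤ h ∨ T ≤ 2 * (h : ℝ))) →
              ∑ l ∈ Finset.range (j' + 1), usage x T j' l h * f l h ≤ μ h} = Set.univ := by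
          ext f; simp only [Set.mem_setOf_eq, Set.mem_univ, iff_true]; exact fun hh => absurd hh hc
        rw [this]; exact isClosed_univ
  exact hKc.of_isClosed_subset hclosed hsub

/-- **NORMAL-FORM FLOWS EXIST (minimisers).**  If `μ` has a flow at `(x, T, j′)`, then every functional `Φ` continuous on `ℕ → ℕ → ℝ`
(product topology; e.g. any finite linear combination of the coordinates `f l h` — the giant-routed mass, a routing cost) attains its
MINIMUM on the flow witnesses. [this work] -/
theorem exists_isFlowAtT_isMinOn (x T : ℝ) (j' M : ℕ) (μ : ℕ → ℝ) (Φ : (ℕ → ℕ → ℝ) → ℝ) (hΦ : Continuous Φ)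
    (h : FlowAtT x T j' M μ) :
    ∃ f, IsFlowAtT x T j' M μ f ∧ ∀ f', IsFlowAtT x T j' M μ f' → Φ f ≤ Φ f' := by
  obtain ⟨f₀, hf₀⟩ := (flowAtT_iff_exists_isFlowAtT x T j' M μ).1 h
  obtain ⟨f, hf, hmin⟩ := (isCompact_setOf_isFlowAtT x T j' M μ).exists_isMinOn ⟨f₀, hf₀⟩ hΦ.continuousOn
  exact ⟨f, hf, fun f' hf' => hmin hf'⟩

/-- **NORMAL-FORM FLOWS EXIST (maximisers).** [this work] -/
theorem exists_isFlowAtT_isMaxOn (x T : ℝ) (j' M : ℕ) (μ : ℕ → ℝ) (Φ : (ℕ → ℕ → ℝ) → ℝ) (hΦ : Continuous Φ)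
    (h : FlowAtT x T j' M μ) :
    ∃ f, IsFlowAtT x T j' M μ f ∧ ∀ f', IsFlowAtT x T j' M μ f' → Φ f' ≤ Φ f := by
  obtain ⟨f₀, hf₀⟩ := (flowAtT_iff_exists_isFlowAtT x T j' M μ).1 h
  obtain ⟨f, hf, hmax⟩ := (isCompact_setOf_isFlowAtT x T j' M μ).exists_isMaxOn ⟨f₀, hf₀⟩ hΦ.continuousOn
  exact ⟨f, hf, fun f' hf' => hmax hf'⟩

/-- the coordinate functionals are continuous (for use with `exists_isFlowAtT_isMinOn`): `f ↦ Σ_{l ∈ s} Σ_{h ∈ t} c l h · f l h`. [this work] -/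
theorem continuous_flowFunctional (s t : Finset ℕ) (c : ℕ → ℕ → ℝ) :
    Continuous fun f : ℕ → ℕ → ℝ => ∑ l ∈ s, ∑ h ∈ t, c l h * f l h := by
  refine continuous_finsetSum _ fun l _ => continuous_finsetSum _ fun h _ => ?_
  exact continuous_const.mul ((continuous_apply h).comp (continuous_apply l))

end LawDec

end Quant

end Summit.CriticalPhenomena.PercolationContinuityZ3.Theorems
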